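import Summits.Parity.GeneralizedHardyLittlewood.Theorems.BeyondDiagonalBeatsQuarter.MellinBumpAbel
import HarnessLib

/-!
# Route `PrimeLevelFamEdge`, crux K_B (stmt-Parity-20343), line `diagonal_kernel_split`:
# prover check C2 (discrete form) — a periodic density against a bump is its MEAN times the complete sum,
# up to `O(period variation × bump variation)`

GATE G1 §4 (v) / §6 C2 (`Cruxes/BeyondDiagonalBeatsQuarter/GATE-G1-czero.md`): in the principal part a8P of
the dispersion the prime-vs-integer density mismatch factors (`d/φ(d)`, coprimality with `A` and with `cs`)
are PERIODIC functions `g` of the shift parameter `s`; decomposing `g = ḡ + (g − ḡ)` (mean over a period plus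
a mean-zero periodic part), the mean multiplies the complete smooth `s`-sum (which vanishes at order `ms`,
G1 §4 (ii): `∫Φ = 0`), and the mean-zero part sees only the VARIATION of the bump: a mean-zero `d`-periodic
sequence has partial sums bounded by one period (`abs_partialSum_periodic_le`), so by Abel summation
(`abs_sum_mul_le_of_tv`, C1 part 2)
`|Σ_{s ≤ w} g(s)Φ(s) − ḡ·Σ_{s ≤ w} Φ(s)| ≤ (Σ_{period} |g − ḡ|)·(Σ_{s ≤ w} |Φ(s) − Φ(s+1)| + |Φ(1)|)`
(`abs_sum_periodic_mul_sub_mean_le`) — negligible against the trivial size `w·sup|g|·sup|Φ|` exactly when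
the bump is wide against the period (`w ≫ d`), i.e. away from the transition windows `c ≳ C₀/d′` of G1 §4 (iv),
which C1 (`MellinBump.mellinBump_xsq`) handles. This is the DISCRETE form of C2 (saving `d/H`); the Poisson
form with Schwartz decay `(d/H)^k` (Mathlib `SchwartzMap.tsum_eq_tsum_fourierIntegral`) is not needed at order
`ms` and is left to the Ω-e prover if a power of the saving is ever required. Sums over `s ∈ ℤ` split into
`s > 0`, `s = 0`, `s < 0` (the reflected sequence is again periodic). Helper; closes nothing; theorems only.
«The programme SEARCHES and TYPES; no claim about Landau–Siegel zeros, Theorems 1–2 of arXiv:2211.02515 or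
a repaired Margin232 until a kernel theorem says so.»
-/

noncomputable section

open Finset

namespace Summit.Parity.GeneralizedHardyLittlewood.Theorems.BeyondDiagonalBeatsQuarter.MellinBump

/-! ### Periodic sequences: shift-invariance of period sums, partial sums -/

/-- `Σ_{1 ≤ j ≤ e} f(j) = Σ_{i < e} f(i+1)`. [folklore] -/
theorem sum_Icc_eq_sum_range' (f : ℕ → ℝ) (e : ℕ) :
    ∑ j ∈ Icc 1 e, f j = ∑ i ∈ range e, f (i + 1) := by
  induction e with
  | zero => simp
  | succ e ih => rw [Finset.sum_Icc_succ_top (by omega), ih, Finset.sum_range_succ]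

/-- A period sum of a `d`-periodic sequence does not depend on where it starts:
`Σ_{i < d} g(m + i + 1) = Σ_{i < d} g(i + 1)`. [folklore] -/
theorem sum_range_shift_periodic {g : ℕ → ℝ} {d : ℕ} (hper : ∀ n, g (n + d) = g n) (m : ℕ) :
    ∑ i ∈ range d, g (m + i + 1) = ∑ i ∈ range d, g (i + 1) := by
  induction m with
  | zero => simp
  | succ m ih =>
    rw [← ih]
    rcases Nat.eq_zero_or_pos d with rfl | hd
    · simp
    obtain ⟨d', rfl⟩ : ∃ d', d = d' + 1 := ⟨d - 1, by omega⟩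
    rw [Finset.sum_range_succ, Finset.sum_range_succ' (fun i ↦ g (m + i + 1))]
    have h1 : g (m + 1 + d' + 1) = g (m + 0 + 1) := by
      rw [show m + 1 + d' + 1 = (m + 0 + 1) + (d' + 1) by ring, hper]
    rw [h1]
    congr 1
    exact Finset.sum_congr rfl fun i _ ↦ by ring_nf

/-- Partial sums of a `d`-periodic sequence with vanishing period sum reduce to the last incomplete period:
`Σ_{i < e} a(i+1) = Σ_{i < e mod d} a(i+1)`. [folklore] -/
theorem partialSum_periodic_eq {a : ℕ → ℝ} {d : ℕ} (hper : ∀ n, a (n + d) = a n)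
    (hzero : ∑ i ∈ range d, a (i + 1) = 0) (e : ℕ) :
    ∑ i ∈ range e, a (i + 1) = ∑ i ∈ range (e % d), a (i + 1) := by
  have key : ∀ q r : ℕ, ∑ i ∈ range (q * d + r), a (i + 1) = ∑ i ∈ range r, a (i + 1) := by
    intro q r
    induction q with
    | zero => simp
    | succ q ih =>
      rw [show (q + 1) * d + r = (q * d + r) + d by ring, Finset.sum_range_add, ih,
        sum_range_shift_periodic hper (q * d + r), hzero, add_zero]
  conv_lhs => rw [← Nat.div_add_mod' e d]
  exact key _ _

/-- **A mean-zero periodic sequence has bounded partial sums:** for `g` `d`-periodic (`d ≥ 1`) with period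
mean `ḡ = (Σ_{i ≤ d} g(i))/d`, `|Σ_{j ≤ e} (g(j) − ḡ)| ≤ Σ_{i ≤ d} |g(i) − ḡ|` for every `e`. [folklore] -/
theorem abs_partialSum_periodic_le {g : ℕ → ℝ} {d : ℕ} (hd : 0 < d) (hper : ∀ n, g (n + d) = g n)
    (e : ℕ) :
    |∑ j ∈ Icc 1 e, (g j - (∑ i ∈ Icc 1 d, g i) / d)| ≤
      ∑ i ∈ Icc 1 d, |g i - (∑ i ∈ Icc 1 d, g i) / d| := by
  set gbar : ℝ := (∑ i ∈ Icc 1 d, g i) / d with hgbar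
  have hper' : ∀ n, (fun j ↦ g j - gbar) (n + d) = (fun j ↦ g j - gbar) n := by
    intro n; simp only [hper]
  have hzero : ∑ i ∈ range d, (fun j ↦ g j - gbar) (i + 1) = 0 := by
    rw [← sum_Icc_eq_sum_range' (fun j ↦ g j - gbar)]
    simp only [Finset.sum_sub_distrib, Finset.sum_const, Nat.card_Icc, Nat.add_sub_cancel,
      nsmul_eq_mul]
    have hd0 : (d : ℝ) ≠ 0 := by exact_mod_cast hd.ne'
    rw [hgbar]
    field_simp
    ring
  have h3 := partialSum_periodic_eq (a := fun j ↦ g j - gbar) hper' hzero e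
  rw [sum_Icc_eq_sum_range' _ e, sum_Icc_eq_sum_range' _ d, h3]
  refine (Finset.abs_sum_le_sum_abs _ _).trans ?_
  exact Finset.sum_le_sum_of_subset_of_nonneg (Finset.range_subset_range.2 (Nat.mod_lt e hd).le)
    fun _ _ _ ↦ abs_nonneg _

/-! ### C2 (discrete): periodic density against a bump -/

/-- **C2, discrete form.** For `g` `d`-periodic (`d ≥ 1`) with period mean `ḡ` and a weight `Φ` with
`Φ(w+1) = 0`:
`|Σ_{s ≤ w} g(s)Φ(s) − ḡ·Σ_{s ≤ w} Φ(s)| ≤ (Σ_{i ≤ d} |g(i) − ḡ|)·(Σ_{s ≤ w} |Φ(s) − Φ(s+1)| + |Φ(1)|)` —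
the periodic density is its mean times the complete sum up to (period variation) × (bump variation);
Abel summation against the bounded partial sums of `g − ḡ`. [folklore] -/
theorem abs_sum_periodic_mul_sub_mean_le (g Φ : ℕ → ℝ) {d : ℕ} (hd : 0 < d)
    (hper : ∀ n, g (n + d) = g n) {w : ℕ} (hw : Φ (w + 1) = 0) :
    |∑ s ∈ Icc 1 w, g s * Φ s - (∑ i ∈ Icc 1 d, g i) / d * ∑ s ∈ Icc 1 w, Φ s| ≤
      (∑ i ∈ Icc 1 d, |g i - (∑ i ∈ Icc 1 d, g i) / d|) *
        (∑ s ∈ Icc 1 w, |Φ s - Φ (s + 1)| + |Φ 1|) := by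
  have h1 : ∑ s ∈ Icc 1 w, g s * Φ s - (∑ i ∈ Icc 1 d, g i) / d * ∑ s ∈ Icc 1 w, Φ s =
      ∑ s ∈ Ioc 0 w, (fun j ↦ g j - (∑ i ∈ Icc 1 d, g i) / d) s * Φ s := by
    rw [← Literature.Barriers.Parity.Icc_one_eq_Ioc_zero, Finset.mul_sum, ← Finset.sum_sub_distrib]
    exact Finset.sum_congr rfl fun s _ ↦ by ring
  rw [h1]
  have h2 := abs_sum_mul_le_of_tv (fun j ↦ g j - (∑ i ∈ Icc 1 d, g i) / d) Φ (Nat.zero_le w)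
    (η := ∑ i ∈ Icc 1 d, |g i - (∑ i ∈ Icc 1 d, g i) / d|)
    (fun e _ _ _ ↦ abs_partialSum_periodic_le hd hper e) hw
  rwa [← Literature.Barriers.Parity.Icc_one_eq_Ioc_zero] at h2

/-- **C2 with sup norms.** If moreover `|g| ≤ B`, the period variation is at most `2dB`:
`|Σ_{s ≤ w} g(s)Φ(s) − ḡ·Σ_{s ≤ w} Φ(s)| ≤ 2dB·(Σ_{s ≤ w} |Φ(s) − Φ(s+1)| + |Φ(1)|)`. [folklore] -/
theorem abs_sum_periodic_mul_sub_mean_le' (g Φ : ℕ → ℝ) {d : ℕ} (hd : 0 < d)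
    (hper : ∀ n, g (n + d) = g n) {B : ℝ} (hB : ∀ n, |g n| ≤ B) {w : ℕ} (hw : Φ (w + 1) = 0) :
    |∑ s ∈ Icc 1 w, g s * Φ s - (∑ i ∈ Icc 1 d, g i) / d * ∑ s ∈ Icc 1 w, Φ s| ≤
      2 * d * B * (∑ s ∈ Icc 1 w, |Φ s - Φ (s + 1)| + |Φ 1|) := by
  refine (abs_sum_periodic_mul_sub_mean_le g Φ hd hper hw).trans
    (mul_le_mul_of_nonneg_right ?_ (by positivity))
  have hB0 : 0 ≤ B := (abs_nonneg _).trans (hB 0)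
  have hmean : |(∑ i ∈ Icc 1 d, g i) / d| ≤ B := by
    rw [abs_div, Nat.abs_cast, div_le_iff₀ (by exact_mod_cast hd)]
    calc |∑ i ∈ Icc 1 d, g i| ≤ ∑ i ∈ Icc 1 d, |g i| := Finset.abs_sum_le_sum_abs _ _
      _ ≤ ∑ i ∈ Icc 1 d, B := Finset.sum_le_sum fun i _ ↦ hB i
      _ = B * d := by rw [Finset.sum_const, Nat.card_Icc, Nat.add_sub_cancel, nsmul_eq_mul]; ring
  calc ∑ i ∈ Icc 1 d, |g i - (∑ i ∈ Icc 1 d, g i) / d| ≤ ∑ i ∈ Icc 1 d, (B + B) :=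
        Finset.sum_le_sum fun i _ ↦ (abs_sub _ _).trans (add_le_add (hB i) hmean)
    _ = 2 * d * B := by rw [Finset.sum_const, Nat.card_Icc, Nat.add_sub_cancel, nsmul_eq_mul]; ring

end Summit.Parity.GeneralizedHardyLittlewood.Theorems.BeyondDiagonalBeatsQuarter.MellinBump
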